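import Literature.AlgebraicGeometry.Motives.ProjectiveNoetherNormalization
import Literature.AlgebraicGeometry.Motives.CartierDivisorEffective
import Literature.AlgebraicGeometry.Motives.CartierDivisorBlowupExcess
import Literature.AlgebraicGeometry.Motives.GeneratingSectionsOfHomAppLE
import Literature.AlgebraicGeometry.Motives.VarietiesProperProofs
import Literature.AlgebraicGeometry.Motives.SegreEmbedding
import Literature.AlgebraicGeometry.HodgeTheory.KodairaSerreSectionsProofs
import HarnessLib

/-!
# Serre's theorem A for the line bundles `𝒪(D₀ + mH)`, `H` ample, in Cartier form; effective
# divisors plus hyperplane sections are multiples of the hyperplane class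

For an integral scheme `Y` carrying an ample Cartier divisor `H` (`Motives/CartierDivisor`,
`CartierDivisor.IsAmple`, Görtz–Wedhorn I, Prop. 13.47 (iv)) and ANY Cartier divisor `D₀` on `Y`, the
sheaf `𝒪_Y(D₀ + mH)` is generated by finitely many global sections for suitable `m`
(`CartierDivisor.IsAmple.exists_isSection_add_smul_cover`: sections `s_0, …, s_M ∈ Γ(Y, 𝒪(D₀ + mH))`,
all non-zero, whose non-vanishing loci cover `Y`). This is Serre's theorem A (Hartshorne II Thm. 5.17;
Görtz–Wedhorn I, Def. 13.44 / Prop. 13.47 (i)) for the coherent sheaf `𝓕 = 𝒪_Y(D₀)`, proved here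
WITHOUT coherent sheaves, inside `K(Y)`: at a point `y` choose a chart `U_a ∋ y` of `D₀` and a section
`t` of some `𝒪(bH)` with `y ∈ Y_t ⊆ U_a` (Prop. 13.47 (iv) ⇒ (iii), the tree's
`IsAmple.exists_forall_le_isSection_affine` and `exists_isSection_nonvanishing_subset`); on `Y_t` the
sheaf `𝒪(D₀)` is trivialised by `f_a⁻¹`, and `t^N f_a⁻¹` extends to a global section of
`𝒪(D₀ + (bN)H)` (Görtz–Wedhorn I, Thm. 7.22 (2), the tree's
`CartierDivisor.exists_isSection_add_smul_pow_mul`) which generates on `Y_t`; finitely many `Y_t` cover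
the quasi-compact `Y`, and the degrees are equalised by powers of the `t`.

Consequence for a closed subvariety `ι : T ↪ ℙᴺ_ℂ` with hyperplane divisor `H_ι = div(ι^*x_{j₀})`
(`GeneratingSections.divisor`, ample by `GeneratingSections.isAmple_divisor`) and a Cartier divisor `E`
on `T` (`CartierDivisor.exists_add_divisor_ofHom_linEquiv_smul`, and its registered form
`CartierDivisor.effectiveCartier_linEquiv_hyperplanePullbacks` for effective `E`): the generating
sections `s_k` of `𝒪(mH_ι − E)` define a morphism `F : T → ℙᴹ_ℂ` (Hartshorne II Thm. 7.1,
`CartierDivisor.toGeneratingSections`, `GeneratingSections.toProjectiveSpace`) whose hyperplane divisor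
`D_F = div(F^*x_0)` has local equations `F^*(x_0/x_l) = s_0/s_l`
(`GeneratingSections.ratioFn_ofHom_toProj`), so that `E + D_F ∼ m • H_ι` (the unit `h = s_0⁻¹`).
This is the scheme-theoretic input "every effective divisor is a difference of hyperplane sections
of projective embeddings, up to linear equivalence" of the Lefschetz-(1,1) bookkeeping in
`HodgeTheory`.

Everything is proved; no definitions, no named facts. Effectivity of `E` is not used (the statement
holds for every Cartier divisor); smoothness of `T` is not used (only properness, which follows from
the closed immersion).

## References

* R. Hartshorne, *Algebraic Geometry*, GTM 52, Springer (1977): II Thm. 5.17 (p. 121), II Thm. 7.1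
  (p. 150), II Prop. 7.7 (a). [Hartshorne1977]
* U. Görtz, T. Wedhorn, *Algebraic Geometry I: Schemes*, 2nd ed., Springer Spektrum (2020),
  doi:10.1007/978-3-658-30733-2: Thm. 7.22 (2) (p. 230); (11.9) (p. 374); Def. 13.44 and Prop. 13.47
  (pp. 492–494). [GortzWedhorn2020]

#harness_tags algebraic_geometry.ample_divisors, algebraic_geometry.projective_varieties
-/

universe u

open CategoryTheory AlgebraicGeometry Limits HomogeneousLocalization TopologicalSpace Opposite
open Literature.AlgebraicGeometry.Motives.Segre Literature.AlgebraicGeometry.Motives.RatFn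

noncomputable section

namespace Literature.AlgebraicGeometry.Motives

/-! ### The ratios of the morphism defined by generating sections -/

namespace GeneratingSections

variable {d : ℕ} {K : Type u} [Field K] {Y : Scheme.{u}} [IsIntegral Y]
  (G : GeneratingSections (Fin (d + 1)) Y) (f₀ : Y ⟶ Spec (.of K))

/-- **`F^*(x_j/x_l) = s_j/s_l` in `K(Y)` for the morphism `F = G.toProj f₀ : Y → ℙᵈ` of generating
sections `s`** (Hartshorne II Thm. 7.1 (b): "`s_i = φ^*(x_i)`"), for an ARBITRARY (not necessarily
dominant) such morphism: the rational function of the ratio `F^*(x_j/x_l) ∈ Γ(F⁻¹D₊(x_l), 𝒪_Y)` of the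
generating sections `GeneratingSections.ofHom F` is the rational function of `G.ratio l j = s_j/s_l`.
(The tree's `functionFieldMap_toProj_awayToFunctionField_frac` is the same identity read through
`F^♯ : K(ℙᵈ) → K(Y)`, which needs `F` dominant.) [cite: Hartshorne1977, II Thm. 7.1 (b)] -/
theorem ratioFn_ofHom_toProj (l j : Fin (d + 1))
    (h : genericPoint Y ∈ (ofHom (G.toProj f₀)).U l) (h' : genericPoint Y ∈ G.U l) :
    (ofHom (G.toProj f₀)).ratioFn l j h = ofSection h' (G.ratio l j) := by
  -- adapted from `GeneratingSections.functionFieldMap_toProj_awayToFunctionField_frac`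
  -- (`Motives/ToProjFunctionField`): `homRatio (F ≫ 𝟙) = F^*(sec (x_j/x_l))` and `app_sec`
  have hle : G.toProj f₀ ⁻¹ᵁ ProjSpace.U l ≤ G.U l := (G.toProj_preimage_U f₀ l).le
  have key : ∀ χ : Y ⟶ ProjSpace.P d K, G.toProj f₀ ≫ 𝟙 _ = χ →
      ∀ hχ : genericPoint Y ∈ (ofHom χ).U l,
        (ofHom χ).ratioFn l j hχ = ofSection h' (G.ratio l j) := by
    rintro χ rfl hχ
    change ofSection hχ (homRatio (G.toProj f₀ ≫ 𝟙 _) l j) = _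
    rw [homRatio_comp_eq_appLE, ProjSpace.homRatio_id, Scheme.Hom.appLE, CommRingCat.comp_apply,
      G.app_sec f₀ l, chartRingHom_frac,
      show res (G.toProj f₀ ⁻¹ᵁ ProjSpace.U l).ι (G.U l) (G.top_le_preimage_U f₀ l) (G.ratio l j) =
          res (G.toProj f₀ ⁻¹ᵁ ProjSpace.U l).ι (G.U l) (top_le_ι_preimage_of_le hle) (G.ratio l j)
        from rfl, topIso_hom_res hle]
    exact (ofSection_map _ _ _).trans (ofSection_map _ _ _)
  exact key _ (Category.comp_id _) h

end GeneratingSections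

/-! ### Serre's theorem A for `𝒪(D₀ + mH)` in Cartier form -/

namespace CartierDivisor

variable {Y : Scheme.{u}} [IsIntegral Y]

/-- **Serre's theorem A for the line bundles `𝒪_Y(D₀ + mH)`, `H` ample** (Hartshorne II Thm. 5.17 /
Görtz–Wedhorn I, Def. 13.44 for `𝓕 = 𝒪_Y(D₀)`, `𝓛 = 𝒪_Y(H)`), in the concrete model of
`Motives/CartierDivisor`: there are `m`, `M` and non-zero global sections `s_0, …, s_M` of
`𝒪_Y(D₀ + mH)` whose non-vanishing loci cover `Y` (i.e. generating it). Proof: at each point `y` a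
chart `U_a ∋ y` of `D₀` and `t ∈ Γ(Y, 𝒪(bH))`, `b ≥ 1`, with `y ∈ Y_t ⊆ U_a` (Prop. 13.47 (iii));
`𝒪(D₀)|_{U_a}` is trivialised by `f_a⁻¹`, and `t^n f_a⁻¹ ∈ Γ(Y, 𝒪(D₀ + (bn)H))` for `n ≫ 0`
(Thm. 7.22 (2)) with `(f_a h_j^{bn}) · t^n f_a⁻¹ = (h_j^b t)^n` a unit on `Y_t`; finitely many `Y_t`
cover `Y`, and `m = (Π b) · max n`.
[cite: GortzWedhorn2020, Thm. 7.22 (2) (p. 230) and Prop. 13.47 (p. 493)] -/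
theorem IsAmple.exists_isSection_add_smul_cover {H : CartierDivisor Y} (hH : H.IsAmple)
    (D₀ : CartierDivisor Y) :
    ∃ (m M : ℕ) (s : Fin (M + 1) → Y.functionField),
      (∀ k, (D₀ + m • H).IsSection (s k)) ∧ (∀ k, s k ≠ 0) ∧
      ∀ y : Y, ∃ k, y ∈ (D₀ + m • H).nonvanishing (s k) := by
  classical
  haveI : CompactSpace Y := hH.1
  obtain ⟨n₀, hn₀⟩ := hH.exists_forall_le_isSection_affine
  -- (1) at each point: a chart `U_a ∋ y` of `D₀` and `t ∈ Γ(Y, 𝒪(bH))`, `b ≥ 1`, `y ∈ Y_t ⊆ U_a`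
  have step : ∀ y : Y, ∃ (a : D₀.ι) (b : ℕ) (t : Y.functionField), 0 < b ∧ (b • H).IsSection t ∧
      y ∈ (b • H).nonvanishing t ∧ (b • H).nonvanishing t ⊆ (D₀.U a : Set Y) := by
    intro y
    obtain ⟨a, hya⟩ := D₀.covers y
    obtain ⟨τ, hτ, hyτ, haff⟩ := hn₀ (n₀ + 1) (Nat.le_succ n₀) y
    obtain ⟨b, t, hb, ht, hyt, htW, -, -⟩ :=
      exists_isSection_nonvanishing_subset (Nat.succ_pos n₀) hτ haff hyτ (W := D₀.U a) hya
    exact ⟨a, b, t, hb, ht, hyt, htW⟩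
  choose a b t hb ht hyt htU using step
  have ht0 : ∀ y, t y ≠ 0 := fun y => ne_zero_of_mem_nonvanishing (hyt y)
  -- (2) extension (Thm. 7.22 (2)): `t^n f_a⁻¹ ∈ Γ(Y, 𝒪(D₀ + (bn)H))` for all `n ≥ N`
  have hβ : ∀ y, D₀.IsSectionOn ((b y • H).nonvanishing (t y)) (D₀.f (a y))⁻¹ :=
    fun y i z hi hz => by
      rw [← div_eq_mul_inv]
      exact (D₀.isUnitAt_div i (a y) z hi (htU y hz)).isRegularAt
  choose N hN using fun y => D₀.exists_isSection_add_smul_pow_mul H (ht y) (hβ y)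
  have hN' : ∀ (y : Y) (n : ℕ), N y ≤ n →
      (D₀ + (b y * n) • H).IsSection (t y ^ n * (D₀.f (a y))⁻¹) := by
    intro y n hn p z hp
    obtain ⟨e, rfl⟩ := Nat.exists_eq_add_of_le hn
    have h1 : IsRegularAt z (D₀.f p.1 * H.f p.2 ^ (b y * N y) * (t y ^ N y * (D₀.f (a y))⁻¹)) :=
      hN y p z hp
    have h2 : IsRegularAt z (H.f p.2 ^ b y * t y) := ht y p.2 z hp.2
    change IsRegularAt z (D₀.f p.1 * H.f p.2 ^ (b y * (N y + e)) * (t y ^ (N y + e) * (D₀.f (a y))⁻¹))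
    have e1 : D₀.f p.1 * H.f p.2 ^ (b y * (N y + e)) * (t y ^ (N y + e) * (D₀.f (a y))⁻¹) =
        D₀.f p.1 * H.f p.2 ^ (b y * N y) * (t y ^ N y * (D₀.f (a y))⁻¹) *
          (H.f p.2 ^ b y * t y) ^ e := by
      ring
    rw [e1]
    exact h1.mul (h2.pow e)
  -- (3) generation on `Y_t`: `(f_a h_j^{bn}) · (t^n f_a⁻¹) = (h_j^b t)^n` is a unit there
  have hgen : ∀ (y : Y) (n : ℕ), ∀ z ∈ (b y • H).nonvanishing (t y),
      z ∈ (D₀ + (b y * n) • H).nonvanishing (t y ^ n * (D₀.f (a y))⁻¹) := by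
    intro y n z hz
    have hza : z ∈ D₀.U (a y) := htU y hz
    obtain ⟨j, hzj, hu⟩ := hz
    refine ⟨(a y, j), ⟨hza, hzj⟩, ?_⟩
    change IsUnitAt z (H.f j ^ b y * t y) at hu
    change IsUnitAt z (D₀.f (a y) * H.f j ^ (b y * n) * (t y ^ n * (D₀.f (a y))⁻¹))
    have e1 : D₀.f (a y) * H.f j ^ (b y * n) * (t y ^ n * (D₀.f (a y))⁻¹) =
        (H.f j ^ b y * t y) ^ n := by
      have h0 := D₀.f_ne_zero (a y)
      field_simp
      ring
    rw [e1]
    exact hu.pow n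
  -- (4) finitely many `Y_{t y}` cover `Y`
  obtain ⟨S, hS⟩ := isCompact_univ.elim_finite_subcover (fun y : Y => (b y • H).nonvanishing (t y))
    (fun y => (b y • H).isOpen_nonvanishing (t y)) (fun z _ => Set.mem_iUnion.2 ⟨z, hyt z⟩)
  have hSne : S.Nonempty := by
    obtain ⟨y, hy, -⟩ := Set.mem_iUnion₂.1 (hS (Set.mem_univ (genericPoint Y)))
    exact ⟨y, hy⟩
  obtain ⟨M, hM⟩ : ∃ M, S.card = M + 1 :=
    Nat.exists_eq_succ_of_ne_zero (Finset.card_ne_zero.2 hSne)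
  let eM : Fin (M + 1) ≃ ↥S := (S.equivFin.trans (finCongr hM)).symm
  -- (5) a common degree `m = (Π_{y ∈ S} b y) · L`, `L = max_{y ∈ S} N y`
  have hP0 : 0 < ∏ y' ∈ S, b y' := Finset.prod_pos fun y' _ => hb y'
  have hdiv : ∀ y ∈ S, ∃ c : ℕ, ∏ y' ∈ S, b y' = b y * c ∧ N y ≤ c * S.sup N := by
    intro y hy
    obtain ⟨c, hc⟩ := Finset.dvd_prod_of_mem b hy
    have hc0 : 0 < c := Nat.pos_of_ne_zero fun h0 => by
      rw [h0, mul_zero] at hc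
      exact hP0.ne' hc
    exact ⟨c, hc, (Finset.le_sup (f := N) hy).trans (Nat.le_mul_of_pos_left _ hc0)⟩
  choose! c hc hNc using hdiv
  refine ⟨(∏ y' ∈ S, b y') * S.sup N, M,
    fun k => t (eM k) ^ (c (eM k) * S.sup N) * (D₀.f (a (eM k)))⁻¹, fun k => ?_,
    fun k => mul_ne_zero (pow_ne_zero _ (ht0 _)) (inv_ne_zero (D₀.f_ne_zero _)), fun z => ?_⟩
  · have hk : ((eM k : ↥S) : Y) ∈ S := (eM k).2
    rw [show (∏ y' ∈ S, b y') * S.sup N = b (eM k) * (c (eM k) * S.sup N) by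
      rw [hc _ hk, mul_assoc]]
    exact hN' _ _ (hNc _ hk)
  · obtain ⟨y, hyS, hzy⟩ : ∃ y ∈ S, z ∈ (b y • H).nonvanishing (t y) := by
      simpa only [Set.mem_iUnion, exists_prop] using hS (Set.mem_univ z)
    refine ⟨eM.symm ⟨y, hyS⟩, ?_⟩
    simp only [Equiv.apply_symm_apply]
    rw [show (∏ y' ∈ S, b y') * S.sup N = b y * (c y * S.sup N) by rw [hc _ hyS, mul_assoc]]
    exact hgen y _ z hzy

end CartierDivisor

/-! ### Effective divisors plus hyperplane sections are multiples of the hyperplane class -/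

/-- **For a closed subvariety `ι : T ↪ ℙᴺ_ℂ` and a Cartier divisor `E` on `T` there are `m`, a
morphism `F : T → ℙᴹ_ℂ` and a hyperplane divisor `D_F = div(F^*x_{k₀})` with `E + D_F ∼ m • H_ι`**,
`H_ι = div(ι^*x_{j₀})` the hyperplane divisor of `ι` (Hartshorne II Thm. 5.17 with II Thm. 7.1: the
sections `s_k` of `𝒪(mH_ι − E)` generate for suitable `m`, `F` is the morphism they define, and
`D_F = div(s_0) + (mH_ι − E)` since `F^*(x_0/x_l) = s_0/s_l` on `F⁻¹D₊(x_l) = T_{s_l}`; the unit of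
the linear equivalence is `h = s_0⁻¹`). Here with `k₀ = 0`.
[cite: Hartshorne1977, II Thm. 5.17 (p. 121) and II Thm. 7.1 (p. 150)] -/
theorem CartierDivisor.exists_add_divisor_ofHom_linEquiv_smul {N : ℕ} {T : SchemeOver ℂ}
    [IsIntegral T.left] (ι : T ⟶ projectiveSpace N ℂ) [hι : IsClosedImmersion ι.left]
    (j₀ : Fin (N + 1)) (hj₀ : genericPoint T.left ∈ (GeneratingSections.ofHom ι.left).U j₀)
    (E : CartierDivisor T.left) :
    ∃ (m M : ℕ) (F : T ⟶ projectiveSpace M ℂ) (k₀ : Fin (M + 1))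
      (hk₀ : genericPoint T.left ∈ (GeneratingSections.ofHom F.left).U k₀),
      (E + (GeneratingSections.ofHom F.left).divisor k₀ hk₀).LinEquiv
        (m • (GeneratingSections.ofHom ι.left).divisor j₀ hj₀) := by
  classical
  -- `T` is proper over `ℂ` (closed in `ℙᴺ`), hence quasi-compact and quasi-separated
  haveI : IsProper (T.left ↘ Spec (.of ℂ)) := IsProjectiveOver.isProper (X := T) ⟨N, ι, hι⟩
  haveI : CompactSpace T.left := compactSpace_of_isProper ℂ T.left
  haveI : QuasiSeparatedSpace T.left :=
    quasiSeparatedSpace_of_quasiSeparated (T.left ↘ Spec (.of ℂ))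
  -- the hyperplane divisor `H` of `ι` is ample (its charts `ι⁻¹D₊(x_a)` are affine)
  haveI : IsClosedImmersion (Y := ProjSpace.P N ℂ) ι.left := hι
  set Gι : GeneratingSections (Fin (N + 1)) T.left := GeneratingSections.ofHom ι.left with hGι
  have hHa : (Gι.divisor j₀ hj₀).IsAmple :=
    Gι.isAmple_divisor j₀ hj₀ (GeneratingSections.isAffineOpen_ofHom_U ι.left)
  -- Serre A for `𝒪(-E)`: non-zero sections `s_k` of `𝒪(mH - E)` without common zero
  obtain ⟨m, M, s, hs, hs0, hcov⟩ :=
    hHa.exists_isSection_add_smul_cover ((0 : CartierDivisor T.left).sub E)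
  set D' : CartierDivisor T.left := (0 : CartierDivisor T.left).sub E + m • Gι.divisor j₀ hj₀
    with hD'
  have hξ : ∀ k, genericPoint T.left ∈ D'.nonvanishingOpens (s k) := fun k => by
    obtain ⟨p, hp⟩ := D'.covers (genericPoint T.left)
    exact ⟨p, hp, isUnitAt_genericPoint (mul_ne_zero (D'.f_ne_zero p) (hs0 k))⟩
  set G : GeneratingSections (Fin (M + 1)) T.left := D'.toGeneratingSections s hs hξ hcov with hG
  -- the morphism `F : T ⟶ ℙᴹ` of the `s_k`; `F⁻¹D₊(x_l) = T_{s_l}`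
  have hk₀ : genericPoint T.left ∈
      (GeneratingSections.ofHom (G.toProjectiveSpace (Z := T)).left).U 0 := by
    change genericPoint T.left ∈ G.toProj T.hom ⁻¹ᵁ ProjSpace.U 0
    rw [G.toProj_preimage_U]
    exact hξ 0
  refine ⟨m, M, G.toProjectiveSpace, 0, hk₀, ?_⟩
  rw [CartierDivisor.linEquiv_iff]
  refine ⟨(s 0)⁻¹, inv_ne_zero (hs0 0), ?_⟩
  rintro ⟨b, ⟨⟨l, hl⟩⟩⟩ j x ⟨hxb, hxl⟩ hxj
  have hxl' : x ∈ D'.nonvanishing (s l) := by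
    have h1 : x ∈ G.toProj T.hom ⁻¹ᵁ ProjSpace.U l := hxl
    rw [G.toProj_preimage_U] at h1
    exact h1
  have hu : IsUnitAt x (D'.f ((PUnit.unit, b), j) * s l) :=
    (D'.mem_nonvanishing_iff (i := ((PUnit.unit, b), j)) ⟨⟨trivial, hxb⟩, hxj⟩).1 hxl'
  -- the local equation of `D_F` on `F⁻¹D₊(x_l)` is `F^*(x_0/x_l) = s_0 / s_l`
  have hf : (GeneratingSections.ofHom (G.toProjectiveSpace (Z := T)).left).ratioFn l 0 hl =
      s 0 / s l :=
    (G.ratioFn_ofHom_toProj T.hom l 0 hl (hξ l)).trans (D'.germ_ratio s hs hξ l 0 (hξ l))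
  change IsUnitAt x (E.f b *
    (GeneratingSections.ofHom (G.toProjectiveSpace (Z := T)).left).ratioFn l 0 hl * (s 0)⁻¹ /
      (Gι.divisor j₀ hj₀).f j ^ m)
  rw [hf]
  change IsUnitAt x (1 / E.f b * (Gι.divisor j₀ hj₀).f j ^ m * s l) at hu
  have e1 : E.f b * (s 0 / s l) * (s 0)⁻¹ / (Gι.divisor j₀ hj₀).f j ^ m =
      (1 / E.f b * (Gι.divisor j₀ hj₀).f j ^ m * s l)⁻¹ := by
    have h1 := E.f_ne_zero b
    have h2 := (Gι.divisor j₀ hj₀).f_ne_zero j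
    have h3 := hs0 0
    have h4 : s l ≠ 0 := ne_zero_of_mem_nonvanishing hxl'
    field_simp
  rw [e1]
  exact hu.inv

/-- **Registered form** (stub `stub_effectiveCartier_linEquiv_hyperplanePullbacks` of the
`VerticalSupportMiddle` skeleton): on a smooth projective complex variety `T` with a closed immersion
`ι : T ↪ ℙᴺ` and hyperplane divisor `H_ι = div(ι^*x_{j₀})`, every effective Cartier divisor `E`
satisfies `E + D_F ∼ m • H_ι` for some `m`, some morphism `F : T → ℙᴹ` and its hyperplane divisor
`D_F = div(F^*x_{k₀})` (Hartshorne II Thm. 5.17 with II Thm. 7.1; smoothness and effectivity are not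
needed, `CartierDivisor.exists_add_divisor_ofHom_linEquiv_smul`).
[cite: Hartshorne1977, II Thm. 5.17 (p. 121) and II Thm. 7.1 (p. 150)] -/
theorem CartierDivisor.effectiveCartier_linEquiv_hyperplanePullbacks :
    ∀ ⦃n N : ℕ⦄ ⦃T : SchemeOver ℂ⦄ [IsIntegral T.left] (_hT : IsSmoothProjective n T)
      (ι : T ⟶ projectiveSpace N ℂ) [IsClosedImmersion ι.left] (j₀ : Fin (N + 1))
      (hj₀ : genericPoint T.left ∈ (GeneratingSections.ofHom ι.left).U j₀)
      (E : CartierDivisor T.left), E.IsEffective →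
      ∃ (m M : ℕ) (F : T ⟶ projectiveSpace M ℂ) (k₀ : Fin (M + 1))
        (hk₀ : genericPoint T.left ∈ (GeneratingSections.ofHom F.left).U k₀),
        (E + (GeneratingSections.ofHom F.left).divisor k₀ hk₀).LinEquiv
          (m • (GeneratingSections.ofHom ι.left).divisor j₀ hj₀) := by
  intro n N T _ _ ι _ j₀ hj₀ E _
  exact CartierDivisor.exists_add_divisor_ofHom_linEquiv_smul ι j₀ hj₀ E

end Literature.AlgebraicGeometry.Motives

end
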